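import Summits.CriticalPhenomena.PercolationContinuityZ3.Theorems.PercNearOneGluingNoHeavyPcintBSMAssembly
import Summits.CriticalPhenomena.PercolationContinuityZ3.Theorems.PercNearOneGluingNoHeavyPcintOSMCompute
import HarnessLib

/-!
# PCINT lane, PHASE 5 (block-renewal second moment), step 9: the kernel layer

Cell `prim-pcint`, seat `prim-pcint-1` (gen 14); memo `run/shared/lean/prim/pcint/T-FIBRE-ROUTE.md` §PHASE 5.

Kernel mirrors of the ingredients of `BSM.criticalProb_le_of_cert`, part 1: FIXED-POINT upper rows of the lazy walk
(`BSM.frowU`: denominator `D`, the three-term recursion `BSM.F_succ` in one linear pass per row with upward rounding;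
**`BSM.frowU_getD`**: `F (a/b) n δ · D ≤ row_n[δ + n]`, by monotonicity of the recursion), the oriented meeting
probabilities `u k n` as exact rationals from the tree's `OSM.vrow` (`BSM.uqv_cast`), the fixed-point Green sums
(`BSM.GqN`, `BSM.termsU`; **`BSM.G0N_le_GqN`**, **`BSM.G1N_le_GqN`**: `G0N · DU·D^t ≤ GqN` for coefficient lists
dominating `u k i · DU`, `cadj k i · DU`), and their invariance under signed permutations of the offset (`BSM.canonK`,
`BSM.G0N_canonK`: tables need only be checked on sorted offsets).  All kernel arithmetic is on small naturals.
-/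

noncomputable section

namespace Summit.CriticalPhenomena.PercolationContinuityZ3.Theorems.Pcint.BSM

open Finset OSM Literature.Probability.Percolation Literature.Probability.LatticeModels

variable {t k np : ℕ}

/-! ### Support of `F` -/

/-- `F s N δ = 0` when `|δ| > N`. -/
theorem F_eq_zero_of_lt (s : ℝ) {N : ℕ} {δ : ℤ} (h : (N : ℤ) < |δ|) : F s N δ = 0 := by
  unfold F
  refine sum_eq_zero fun ij hij => ?_
  have hi : ij.1 ≤ N := by
    have := Finset.HasAntidiagonal.mem_antidiagonal.1 hij; omega
  have hcc : cc ij.1 δ = 0 := by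
    unfold cc chooseZ
    rcases le_or_gt 0 δ with hδ | hδ
    · rw [abs_of_nonneg hδ] at h
      rw [if_pos (by omega)]
      have : 2 * ij.1 < ((ij.1 : ℤ) + δ).toNat := by omega
      rw [Nat.choose_eq_zero_of_lt this]; simp
    · rw [abs_of_neg hδ] at h
      rw [if_neg (by omega)]; simp
  rw [hcc, mul_zero]

/-! ### Integer rows of the lazy walk -/

/-- One step of the three-term recursion on rows (row `n` has index `j ↔ δ = j - n`), in ONE linear pass:
state `(p2, p1)` = the two previous entries; entry `j` is `2(2b-a)·p[j-1] + a·(p[j-2] + p[j])`. -/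
def fstepL (a b : ℕ) : List ℕ → ℕ → ℕ → List ℕ
  | [], p2, p1 => [2 * (2 * b - a) * p1 + a * p2, a * p1]
  | x :: rest, p2, p1 => (2 * (2 * b - a) * p1 + a * (p2 + x)) :: fstepL a b rest p1 x

/-- Length of the linear step. -/
theorem length_fstepL (a b : ℕ) : ∀ (l : List ℕ) (p2 p1 : ℕ), (fstepL a b l p2 p1).length = l.length + 2
  | [], _, _ => rfl
  | x :: rest, p2, p1 => by rw [fstepL, List.length_cons, length_fstepL, List.length_cons]

/-- Entries of the linear step, in terms of the virtual list `p2 :: p1 :: l`. -/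
theorem fstepL_getD (a b : ℕ) : ∀ (l : List ℕ) (p2 p1 j : ℕ), (fstepL a b l p2 p1).getD j 0 =
    2 * (2 * b - a) * (p2 :: p1 :: l).getD (j + 1) 0 + a * ((p2 :: p1 :: l).getD j 0 + (p2 :: p1 :: l).getD (j + 2) 0)
  | [], p2, p1, 0 => by simp [fstepL]
  | [], p2, p1, 1 => by simp [fstepL]
  | [], p2, p1, j + 2 => by simp [fstepL]
  | x :: rest, p2, p1, 0 => by simp [fstepL]
  | x :: rest, p2, p1, j + 1 => by
    rw [fstepL, List.getD_cons_succ, fstepL_getD a b rest p1 x j]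
    rfl

/-! ### Fixed-point upper rows of the lazy walk -/

/-- Ceiling division `⌈x / m⌉`. -/
def cdiv (m x : ℕ) : ℕ := (x + (m - 1)) / m

/-- `cdiv m 0 = 0`. -/
theorem cdiv_zero (m : ℕ) : cdiv m 0 = 0 := by
  unfold cdiv; rcases m with _ | m
  · simp
  · exact Nat.div_eq_of_lt (by omega)

/-- `x / m ≤ ⌈x / m⌉` over `ℝ`. -/
theorem le_cdiv {m : ℕ} (hm : 0 < m) (x : ℕ) : (x : ℝ) / m ≤ (cdiv m x : ℝ) := by
  have h1 := Nat.div_add_mod (x + (m - 1)) m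
  have h2 := Nat.mod_lt (x + (m - 1)) hm
  have h3 : x ≤ m * cdiv m x := by unfold cdiv; omega
  rw [div_le_iff₀ (by exact_mod_cast hm : (0 : ℝ) < m)]
  calc (x : ℝ) ≤ ((m * cdiv m x : ℕ) : ℝ) := by exact_mod_cast h3
    _ = (cdiv m x : ℝ) * m := by push_cast; ring

/-- Entries of a row mapped through `cdiv`. -/
theorem getD_map_cdiv (m : ℕ) (l : List ℕ) (j : ℕ) : (l.map (cdiv m)).getD j 0 = cdiv m (l.getD j 0) := by
  have h := List.getD_map (l := l) (n := j) (d := 0) (cdiv m)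
  rwa [cdiv_zero] at h

/-- **Fixed-point upper rows** (denominator `D`): row `0 = [D]`, then the three-term recursion rounded upwards. -/
def frowU (a b D : ℕ) : ℕ → List ℕ
  | 0 => [D]
  | n + 1 => (fstepL a b (frowU a b D n) 0 0).map (cdiv (4 * b))

/-- The rows have length `2n + 1`. -/
theorem length_frowU (a b D : ℕ) : ∀ n, (frowU a b D n).length = 2 * n + 1
  | 0 => rfl
  | n + 1 => by rw [frowU, List.length_map, length_fstepL, length_frowU]; ring

/-- **The fixed-point rows dominate**: `F (a/b) n (j - n) · D ≤ (frowU a b D n)[j]` (every `j`, in range or not). -/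
theorem frowU_getD {a b : ℕ} (hab : a ≤ 2 * b) (hb : 0 < b) (D : ℕ) :
    ∀ (n j : ℕ), F ((a : ℝ) / b) n ((j : ℤ) - n) * D ≤ ((frowU a b D n).getD j 0 : ℝ)
  | 0, j => by
    rw [frowU, F_zero]
    rcases j with _ | j
    · simp
    · rw [List.getD_eq_default _ _ (by simp)]
      have : ((j + 1 : ℕ) : ℤ) - ((0 : ℕ) : ℤ) ≠ 0 := by omega
      rw [if_neg this]; simp
  | n + 1, j => by
    have hbR : (0 : ℝ) < b := by exact_mod_cast hb
    have ih := frowU_getD hab hb D n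
    rw [frowU, getD_map_cdiv, fstepL_getD]
    refine le_trans ?_ (le_cdiv (by omega) _)
    -- the three previous entries dominate the three previous values
    have e1 : F ((a : ℝ) / b) n ((j : ℤ) - (n + 1 : ℕ)) * D ≤
        (((0 :: 0 :: frowU a b D n : List ℕ).getD (j + 1) 0 : ℕ) : ℝ) := by
      rcases j with _ | j
      · rw [F_eq_zero_of_lt _ (by rw [abs_of_neg (by omega)]; push_cast; omega)]; simp
      · simp only [List.getD_cons_succ]
        have := ih j
        rwa [show ((j + 1 : ℕ) : ℤ) - (n + 1 : ℕ) = (j : ℤ) - n by push_cast; ring]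
    have e0 : F ((a : ℝ) / b) n ((j : ℤ) - (n + 1 : ℕ) - 1) * D ≤
        (((0 :: 0 :: frowU a b D n : List ℕ).getD j 0 : ℕ) : ℝ) := by
      rcases j with _ | _ | j
      · rw [F_eq_zero_of_lt _ (by rw [abs_of_neg (by omega)]; push_cast; omega)]; simp
      · rw [F_eq_zero_of_lt _ (by rw [abs_of_neg (by omega)]; push_cast; omega)]; simp
      · simp only [List.getD_cons_succ]
        have := ih j
        rwa [show ((j + 2 : ℕ) : ℤ) - (n + 1 : ℕ) - 1 = (j : ℤ) - n by push_cast; ring]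
    have e2 : F ((a : ℝ) / b) n ((j : ℤ) - (n + 1 : ℕ) + 1) * D ≤
        (((0 :: 0 :: frowU a b D n : List ℕ).getD (j + 2) 0 : ℕ) : ℝ) := by
      simp only [List.getD_cons_succ]
      have := ih j
      rwa [show ((j : ℕ) : ℤ) - (n + 1 : ℕ) + 1 = (j : ℤ) - n by push_cast; ring]
    have hc1 : (0 : ℝ) ≤ 2 * (2 * (b : ℝ) - a) := by
      have : (a : ℝ) ≤ 2 * b := by exact_mod_cast hab
      linarith
    have m1 := mul_le_mul_of_nonneg_left e1 hc1
    have m2 := mul_le_mul_of_nonneg_left (add_le_add e0 e2) (Nat.cast_nonneg a : (0 : ℝ) ≤ a)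
    rw [F_succ]
    push_cast [Nat.cast_sub hab] at m1 m2 ⊢
    have h4 : (0 : ℝ) < 4 * (b : ℝ) := by positivity
    rw [le_div_iff₀ h4]
    have key : ((1 - (a : ℝ) / b / 2) * F ((a : ℝ) / b) n ((j : ℤ) - (n + 1)) +
        (a : ℝ) / b / 4 * (F ((a : ℝ) / b) n ((j : ℤ) - (n + 1) - 1) + F ((a : ℝ) / b) n ((j : ℤ) - (n + 1) + 1))) *
          D * (4 * b) =
        2 * (2 * (b : ℝ) - a) * (F ((a : ℝ) / b) n ((j : ℤ) - (n + 1)) * D) +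
          a * (F ((a : ℝ) / b) n ((j : ℤ) - (n + 1) - 1) * D + F ((a : ℝ) / b) n ((j : ℤ) - (n + 1) + 1) * D) := by
      field_simp
      ring
    rw [key]
    linarith

/-- All rows up to `M`, built with sharing. -/
def frowsU (a b D : ℕ) : ℕ → List (List ℕ)
  | 0 => [frowU a b D 0]
  | M + 1 => let rs := frowsU a b D M; rs ++ [(fstepL a b (rs.getD M []) 0 0).map (cdiv (4 * b))]

/-- The list of rows is correct. -/
theorem frowsU_getD (a b D : ℕ) :
    ∀ (M n : ℕ), n ≤ M → (frowsU a b D M).getD n [] = frowU a b D n ∧ (frowsU a b D M).length = M + 1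
  | 0, n, hn => by
    have : n = 0 := by omega
    subst this; exact ⟨rfl, rfl⟩
  | M + 1, n, hn => by
    have hlen : (frowsU a b D M).length = M + 1 := (frowsU_getD a b D M 0 (Nat.zero_le _)).2
    refine ⟨?_, by simp [frowsU, hlen]⟩
    show (frowsU a b D M ++ [(fstepL a b ((frowsU a b D M).getD M []) 0 0).map (cdiv (4 * b))]).getD n [] =
      frowU a b D n
    rcases Nat.lt_or_ge n (M + 1) with h | h
    · rw [List.getD_append _ _ _ _ (by rw [hlen]; exact h)]
      exact (frowsU_getD a b D M n (by omega)).1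
    · have hn' : n = M + 1 := by omega
      subst hn'
      rw [List.getD_append_right _ _ _ _ (by rw [hlen])]
      rw [hlen, Nat.sub_self, List.getD_cons_zero, (frowsU_getD a b D M M le_rfl).1]
      rfl

/-! ### Short tables and the fixed-point Green sums -/

/-- The entries `δ = -Dd, …, Dd` of a row (index `j ↔ δ = j - Dd`). -/
def fvalsU (row : List ℕ) (n Dd : ℕ) : List ℕ :=
  (List.range (2 * Dd + 1)).map fun j : ℕ => if j + n < Dd then 0 else row.getD (j + n - Dd) 0

/-- **Lookup in the short table dominates `F · D`.** -/
theorem fvalsU_getD {a b : ℕ} (hab : a ≤ 2 * b) (hb : 0 < b) (D n Dd : ℕ) {δ : ℤ} (hδ : -(Dd : ℤ) ≤ δ ∧ δ ≤ Dd) :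
    F ((a : ℝ) / b) n δ * D ≤ (((fvalsU (frowU a b D n) n Dd).getD (δ + Dd).toNat 0 : ℕ) : ℝ) := by
  unfold fvalsU
  rw [getD_map_range _ _ (by omega)]
  by_cases h : δ + n < 0
  · rw [if_pos (by omega), F_eq_zero_of_lt _ (by rw [abs_of_neg (by omega)]; omega)]; simp
  · rw [if_neg (by omega)]
    have := frowU_getD hab hb D n ((δ + Dd).toNat + n - Dd)
    rwa [show ((((δ + Dd).toNat + n - Dd : ℕ) : ℤ) - n) = δ by omega] at this

/-- `u k n` as a rational, read from a row `vr = OSM.vrow k K` of the tree's table. -/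
def uqv (vr : List ℚ) (k n : ℕ) : ℚ := (((Nat.factorial n) ^ 2 : ℕ) : ℚ) * vr.getD n 0 / ((k ^ (2 * n) : ℕ) : ℚ)

/-- **`uqv (OSM.vrow k K)` is `u`.** -/
theorem uqv_cast {k K n : ℕ} (hn : n ≤ K) : ((uqv (OSM.vrow k K) k n : ℚ) : ℝ) = u k n := by
  unfold uqv
  rw [OSM.vrow_getD k K n hn, OSM.u_eq_Mrec]
  have hf : ((Nat.factorial n : ℕ) : ℝ) ≠ 0 := by exact_mod_cast (Nat.factorial_pos n).ne'
  push_cast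
  field_simp

/-- The adjacent-class coefficient as a rational. -/
def cadjqv (vr : List ℚ) (k n : ℕ) : ℚ := ((k : ℚ) ^ 2 * uqv vr k (n + 1) - k * uqv vr k n) / ((k : ℚ) * ((k : ℚ) - 1))

/-- `cadjqv (OSM.vrow k K)` is `cadj`. -/
theorem cadjqv_cast {k K n : ℕ} (hn : n + 1 ≤ K) : ((cadjqv (OSM.vrow k K) k n : ℚ) : ℝ) = cadj k n := by
  unfold cadjqv cadj
  push_cast
  rw [uqv_cast hn, uqv_cast (by omega)]

/-- The fixed-point term data `(W_i, row 2i short table)`, `i < N`, for a coefficient list `W`. -/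
def termsU (a b D N Dd : ℕ) (W : List ℕ) : List (ℕ × List ℕ) :=
  let rs := frowsU a b D (2 * N)
  List.ofFn fun i : Fin N => (W.getD i 0, fvalsU (rs.getD (2 * i) []) (2 * i) Dd)

/-- A fixed-point Green sum from term data: `Σ_i W_i Π_l T_i[δ l]` (a natural number). -/
def GqN (terms : List (ℕ × List ℕ)) (Dd : ℕ) (δ : Fin t → ℤ) : ℕ :=
  (terms.map fun p => p.1 * ∏ l : Fin t, p.2.getD (δ l + Dd).toNat 0).sum

/-- **The fixed-point Green sum dominates** `Σ_{i<N} c_i Π_l F (2i) (δ l) · (DU · D^t)` whenever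
`c_i · DU ≤ W_i`. -/
theorem sum_le_GqN {a b : ℕ} (hab : a ≤ 2 * b) (hb1 : a ≤ b) (hb : 0 < b) (D DU N Dd : ℕ) {W : List ℕ}
    {c : ℕ → ℝ} (hcW : ∀ i < N, c i * DU ≤ (W.getD i 0 : ℝ)) {δ : Fin t → ℤ}
    (hδ : δ ∈ Box t Dd) :
    (∑ i ∈ range N, c i * ∏ l, F ((a : ℝ) / b) (2 * i) (δ l)) * ((DU : ℝ) * (D : ℝ) ^ t) ≤
      ((GqN (termsU a b D N Dd W) Dd δ : ℕ) : ℝ) := by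
  rw [mem_Box] at hδ
  have hbR : (0 : ℝ) < b := by exact_mod_cast hb
  have hs0 : (0 : ℝ) ≤ (a : ℝ) / b := by positivity
  have hs1 : (a : ℝ) / b ≤ 1 := by rw [div_le_one hbR]; exact_mod_cast hb1
  unfold GqN termsU
  rw [List.map_ofFn, List.sum_ofFn, ← Fin.sum_univ_eq_sum_range, sum_mul]
  push_cast
  refine sum_le_sum fun i _ => ?_
  have hiN : (i : ℕ) < N := i.2
  simp only [Function.comp_apply]
  rw [(frowsU_getD a b D (2 * N) (2 * i) (by omega)).1]
  have hT : ∀ l, F ((a : ℝ) / b) (2 * i) (δ l) * D ≤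
      (((fvalsU (frowU a b D (2 * i)) (2 * i) Dd).getD (δ l + Dd).toNat 0 : ℕ) : ℝ) :=
    fun l => fvalsU_getD hab hb D (2 * i) Dd (hδ l)
  calc c i * (∏ l, F ((a : ℝ) / b) (2 * i) (δ l)) * ((DU : ℝ) * (D : ℝ) ^ t)
      = (c i * DU) * ∏ l, (F ((a : ℝ) / b) (2 * i) (δ l) * D) := by
        rw [prod_mul_distrib, prod_const, Finset.card_univ, Fintype.card_fin]; ring
    _ ≤ (W.getD i 0 : ℝ) * ∏ l, (((fvalsU (frowU a b D (2 * i)) (2 * i) Dd).getD (δ l + Dd).toNat 0 : ℕ) : ℝ) := by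
        refine mul_le_mul (hcW i hiN) (prod_le_prod (fun l _ => mul_nonneg (F_nonneg hs0 hs1 _ _) (by positivity))
          fun l _ => hT l) (prod_nonneg fun l _ => mul_nonneg (F_nonneg hs0 hs1 _ _) (by positivity)) (by positivity)
    _ = _ := by push_cast; rfl

/-- **`G0N · (DU · D^t) ≤ GqN`** for a coefficient list dominating `u k i · DU`. -/
theorem G0N_le_GqN {a b : ℕ} (hab : a ≤ b) (hb : 0 < b) (D DU N : ℕ) {U : List ℕ}
    (hU : ∀ i < N, u k i * DU ≤ (U.getD i 0 : ℝ)) {δ : Fin t → ℤ} (hδ : δ ∈ Box t 6) :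
    G0N k ((a : ℝ) / b) N δ * ((DU : ℝ) * (D : ℝ) ^ t) ≤ ((GqN (termsU a b D N 6 U) 6 δ : ℕ) : ℝ) :=
  sum_le_GqN (by omega) hab hb D DU N 6 hU hδ

/-- **`G1N · (DU · D^t) ≤ GqN`** for a coefficient list dominating `cadj k i · DU`. -/
theorem G1N_le_GqN {a b : ℕ} (hab : a ≤ b) (hb : 0 < b) (D DU N : ℕ) {C : List ℕ}
    (hC : ∀ i < N, cadj k i * DU ≤ (C.getD i 0 : ℝ)) {δ : Fin t → ℤ} (hδ : δ ∈ Box t 6) :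
    G1N k ((a : ℝ) / b) N δ * ((DU : ℝ) * (D : ℝ) ^ t) ≤ ((GqN (termsU a b D N 6 C) 6 δ : ℕ) : ℝ) :=
  sum_le_GqN (by omega) hab hb D DU N 6 hC hδ

/-! ### Symmetry of the Green terms: sorted absolute values -/

/-- `F` is even. -/
theorem F_neg (s : ℝ) : ∀ (N : ℕ) (δ : ℤ), F s N (-δ) = F s N δ
  | 0, δ => by rw [F_zero, F_zero]; simp only [neg_eq_zero]
  | N + 1, δ => by
    rw [F_succ_sum, F_succ_sum']
    refine sum_congr rfl fun c _ => ?_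
    rw [show -δ - val c = -(δ + val c) by ring, F_neg s N]

/-- `F` only depends on `|δ|`. -/
theorem F_abs (s : ℝ) (N : ℕ) (δ : ℤ) : F s N |δ| = F s N δ := by
  rcases le_or_gt 0 δ with h | h
  · rw [abs_of_nonneg h]
  · rw [abs_of_neg h, F_neg]

/-- The sorted list of absolute values of the coordinates. -/
def absSort (δ : Fin t → ℤ) : List ℤ := (List.ofFn fun l => |δ l|).insertionSort (· ≤ ·)

/-- **The canonical representative** of `δ` under signed permutations of the coordinates. -/
def canonK (δ : Fin t → ℤ) : Fin t → ℤ := fun i => (absSort δ).getD i 0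

/-- `absSort δ` has length `t`. -/
theorem length_absSort (δ : Fin t → ℤ) : (absSort δ).length = t := by
  simp [absSort, List.length_insertionSort]

/-- `absSort δ` is a permutation of the absolute values. -/
theorem perm_absSort (δ : Fin t → ℤ) : (absSort δ).Perm (List.ofFn fun l => |δ l|) :=
  List.perm_insertionSort _ _

/-- The coordinate list of the canonical representative is `absSort`. -/
theorem ofFn_canonK (δ : Fin t → ℤ) : List.ofFn (canonK δ) = absSort δ := by
  apply List.ext_getElem (by rw [List.length_ofFn, length_absSort])
  intro i h1 h2
  rw [List.getElem_ofFn]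
  unfold canonK
  rw [List.getD_eq_getElem?_getD, List.getElem?_eq_getElem h2, Option.getD_some]

/-- **Products of even functions of the coordinates are invariant under canonicalisation.** -/
theorem prod_F_canonK (s : ℝ) (n : ℕ) (δ : Fin t → ℤ) : ∏ l, F s n (canonK δ l) = ∏ l, F s n (δ l) := by
  rw [← List.prod_ofFn, ← List.prod_ofFn]
  have h1 : List.ofFn (fun l => F s n (canonK δ l)) = (List.ofFn (canonK δ)).map (F s n) := by
    rw [List.map_ofFn]; rfl
  have h2 : List.ofFn (fun l => F s n (δ l)) = (List.ofFn fun l => |δ l|).map (F s n) := by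
    rw [List.map_ofFn]; exact congr_arg _ (funext fun l => (F_abs s n (δ l)).symm)
  rw [h1, h2, ofFn_canonK]
  exact ((perm_absSort δ).map _).prod_eq

/-- The canonical representative of a point of `[-D, D]^t` lies in `[-D, D]^t`. -/
theorem canonK_mem_Box {D : ℕ} {δ : Fin t → ℤ} (h : δ ∈ Box t D) : canonK δ ∈ Box t D := by
  rw [mem_Box] at h ⊢
  intro i
  unfold canonK
  rw [List.getD_eq_getElem?_getD]
  cases hδ : (absSort δ)[(i : ℕ)]? with
  | none => simp
  | some v =>
    simp only [Option.getD_some]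
    have hv : v ∈ absSort δ := List.mem_of_getElem? hδ
    rw [(perm_absSort δ).mem_iff, List.mem_ofFn] at hv
    obtain ⟨l, rfl⟩ := hv
    have := h l
    constructor
    · exact le_trans (by omega) (abs_nonneg _)
    · exact abs_le.2 ⟨this.1, this.2⟩

/-- The entries of the canonical representative are nonnegative. -/
theorem canonK_nonneg (δ : Fin t → ℤ) (i : Fin t) : 0 ≤ canonK δ i := by
  unfold canonK
  rw [List.getD_eq_getElem?_getD]
  cases hδ : (absSort δ)[(i : ℕ)]? with
  | none => simp
  | some v =>
    simp only [Option.getD_some]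
    have hv : v ∈ absSort δ := List.mem_of_getElem? hδ
    rw [(perm_absSort δ).mem_iff, List.mem_ofFn] at hv
    obtain ⟨l, rfl⟩ := hv
    exact abs_nonneg _

/-- `absSort` is sorted. -/
theorem pairwise_absSort (δ : Fin t → ℤ) : (absSort δ).Pairwise (· ≤ ·) := List.pairwise_insertionSort _ _

/-- **Canonicalisation is idempotent.** -/
theorem canonK_canonK (δ : Fin t → ℤ) : canonK (canonK δ) = canonK δ := by
  have h1 : (List.ofFn fun l => |canonK δ l|) = absSort δ := by
    rw [← ofFn_canonK]; exact congr_arg _ (funext fun l => abs_of_nonneg (canonK_nonneg δ l))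
  have h2 : absSort (canonK δ) = absSort δ := by
    unfold absSort; rw [h1]; exact (pairwise_absSort δ).insertionSort_eq
  funext i; show (absSort (canonK δ)).getD i 0 = (absSort δ).getD i 0; rw [h2]

/-- `G0N` is invariant under canonicalisation. -/
theorem G0N_canonK (k : ℕ) (s : ℝ) (N : ℕ) (δ : Fin t → ℤ) : G0N k s N (canonK δ) = G0N k s N δ := by
  unfold G0N; exact sum_congr rfl fun i _ => by rw [prod_F_canonK]

/-- `G1N` is invariant under canonicalisation. -/
theorem G1N_canonK (k : ℕ) (s : ℝ) (N : ℕ) (δ : Fin t → ℤ) : G1N k s N (canonK δ) = G1N k s N δ := by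
  unfold G1N; exact sum_congr rfl fun i _ => by rw [prod_F_canonK]

end Summit.CriticalPhenomena.PercolationContinuityZ3.Theorems.Pcint.BSM

end
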